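import Mathlib
import HarnessLib

/-!
# Markman 2025 — LEMMA 6.2.3 (the unique twisting class `ℓ` making `exp(ℓ)ch(Φ(F₂ ⊠ F₁^∨))` `Spin(V)_P`-invariant):
# the algebra of its proof, REMARK 6.2.4 (`ℓ = (tΞ_P − β₁)/r`) and the derivation of (6.2.5)
# «`c₁(N_g) = ½[c₁(𝒫) − ρ_g(c₁(𝒫))]`» in the proof of LEMMA 6.2.5 — AS PRINTED (v2 p. 34 L44 – p. 35 L62),
# kernel-checked

E. Markman: [M] *Cycles on abelian 2n-folds of Weil type from secant sheaves on abelian n-folds*,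
arXiv:2502.03415 **v2** (2025-06-08), bib `Markman2025SecantWeil` — UNREFEREED PREPRINT. «p. N L m» = PyMuPDF line `m`
of page `N` of the public v2 PDF (sha256/16 `8155aa33870069b8`), read at seat lit-w-markman g22 (pub-hsemireg LIT-W,
2026-08-25; §6.2 from the numbered text layer, p. 34 L44–77 and p. 35 L3–62 re-read BY EYE on the renders
`r_mar25v2_p34_lemma623.png`, `r_mar25v2_p35_lemma623_625.png` in `HOME/lit/Markman-renders-litw-markman-g22/`;
sheet `LOCATOR-SHEET-MARKMAN.md` §68). Lemma 6.2.3 ∕ Remark 6.2.4 are where the class `κ(Φ(F₂ ⊠ F₁^∨)) =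
exp(−β₁/r)ch(Φ(F₂ ⊠ F₁^∨))` of the secant^{⊠2}-object — the object of the pub-hsemireg cell's W1 rows — is shown to be
`Spin(V)_P`-invariant, and Lemma 6.2.5 is the surface case of Proposition 6.1.2 (companion files:
`OrlovEquivarianceDimensionCounts.lean` = Prop. 6.1.2 Steps 2–4, `KappaClassInvariance.lean` = Cor. 1.3.2).

## What is printed (verbatim; displays linearised)

* p. 34 L44–53: «Let `F₁, F₂` be objects in `D^b(X)`, such that `ch(F_i)` belongs to the `K`-secant `P`, for
  `i = 1, 2`, such that the 2-form `Ξ_P` in Corollary 3.2.3 is ample. Denote by `H²(X × X̂, ℚ)_P` the direct sum of all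
  non-trivial irreducible `Spin(V)_P`-subrepresentations of `H²(X × X̂, ℚ)`. Then `H²(X × X̂, ℚ) = H²(X × X̂, ℚ)_P + ℚΞ_P`,
  by Lemma 2.2.7. Let `k` be the minimal non-negative integer, such that `ch_k(Φ(F₂ ⊠ F₁^∨)) ≠ 0`. LEMMA 6.2.3. Assume
  that `k < dim_ℂ(X)`. There exists a unique class `ℓ` of type (1, 1) in `H²(X × X̂, ℚ)_P`, such that the class
  `α := exp(ℓ)ch(Φ(F₂ ⊠ F₁^∨))` is `Spin(V)_P`-invariant. The class `ℓ` depends on the secant line `P`, but not on the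
  choice of `F_i`, `i = 1, 2`.»
* PROOF (p. 34 L54 – p. 35 L21): «… Let `β` be the class `ch(Φ(F₂ ⊠ F₁^∨))` in `H^*(X × X̂, ℚ)`. Then `β` is
  `Spin(V)_P`-invariant with respect to the `ρ′` representation. Set `β_i := ch_i(Φ(F₂ ⊠ F₁^∨))`. Given `g ∈ Spin(V)_P`
  there exists a topological complex line-bundle `N_g` on `X × X̂`, such that (6.2.4) `β = ch(N_g)ρ_g(β)`, by Equation
  (6.1.8). Note that `β_k` is `Spin(V)_P`-invariant with respect to `ρ`, by the minimality of `k`, and is hence a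
  non-zero scalar multiple of `Ξ_P^k`, by the assumption that `k < dim_ℂ(X)`. In particular, the homomorphism
  `β_k ∪ (•) : H²(X × X̂, ℚ) → H^{2k+2}(X × X̂, ℚ)` is injective, as `Ξ_P` is ample. The coset `β_{k+1} + β_k ∪ H²(X × X̂, ℚ)`
  is `Spin(V)_P`-invariant. Hence, `β_{k+1}` belongs to the sum of `β_k ∪ H²(X × X̂, ℚ)` and the `Spin(V)_P`-invariant
  subspace `H^{2k+2}(X × X̂, ℚ)^{Spin(V)_P}`. Thus, there exists a uniques class `ℓ ∈ H²(X × X̂, ℚ)_P`, such that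
  `γ := β_{k+1} + β_kℓ` is `Spin(V)_P`-invariant. Given `g ∈ Spin(V)_P`, Equation (6.2.4) yields the first equality below.
  The invariance of `β_k` and `γ` yields the second equality.
  `ρ_g(β_{k+1}) = −c₁(N_g)β_k + β_{k+1} = γ − [c₁(N_g) + ℓ]β_k`, `ρ_g(β_{k+1}) = ρ_g(γ − β_kℓ) = γ − β_kρ_g(ℓ)`. We
  conclude that `c₁(N_g) = ρ_g(ℓ) − ℓ`, for all `g ∈ Spin(V)_P`, by the injectivity of the cup product with `β_k`. In
  particular, `ℓ = 0`, if and only if `c₁(N_g) = 0`, for all `g ∈ Spin(V)_P`. Furthermore, `ℓ` is determined by `P` and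
  is independent of the choices of `F_i` with `ch(F_i) ∈ P`, `i = 1, 2`. Indeed, if `c₁(N_g) = ρ_g(ℓ′) − ℓ′`, for all
  `g ∈ Spin(V)_P`, for some `ℓ′ ∈ H²(X × X̂, ℚ)_P`, then `ℓ − ℓ′` is a `Spin(V)_P`-invariant class in `H²(X × X̂, ℚ)_P`,
  hence `ℓ′ = ℓ`. Set `α := exp(ℓ)β`. Then `α_{k+1} = γ` and `α` is `Spin(V)_P`-invariant, since `ρ_g(α) =
  ρ_g(exp(ℓ))ρ_g(β) = exp(ρ_g(ℓ))ch(N_g⁻¹)β = exp(ρ_g(ℓ))exp(ℓ − ρ_g(ℓ))β = exp(ℓ)β = α`.»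
* REMARK 6.2.4 (p. 35 L22–30): «Assume `k = 0`, so that the rank `r` of `Φ(F₂ ⊠ F₁^∨)` is non-zero. Set
  `β₁ := c₁(Φ(F₂ ⊠ F₁^∨))`. The class `κ(Φ(F₂ ⊠ F₁^∨)) := exp(−β₁/r)ch(Φ(F₂ ⊠ F₁^∨))` is then `Spin(V)_P`-invariant, by
  Lemma 6.2.3. In this case `ℓ = (tΞ_P − β₁)/r`, where `t` is the unique scalar, such that `ℓ` belongs to
  `H²(X × X̂, ℚ)_P`.»
* LEMMA 6.2.5 and its proof (p. 35 L31–62): «Proposition 6.1.2 holds in case `X` is an abelian surface. Proof. Choose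
  `F₁` and `F₂` to be ideal sheaves of length `n` subschemes with Chern character `w_n = (1, 0, −n)`, `n ≥ 1`. Set
  `E := Rπ_{23,*}(π₁^*F₁^∨ ⊗ F₂)`. The first three graded summands of the Chern character of `E` are
  `ch(E) = −2n − nc₁(𝒫) + [−(n/2)c₁(𝒫)² + n²π_X^*[pt_X] + π_X̂^*[pt_X̂]] + ⋯`, by the proof of [M2, Prop. 11.2] … The
  first Chern class of the object `E` … in Lemma 6.2.3 is `β₁ = −nc₁(𝒫)`. On the other hand, the `K`-secant `P` can be
  chosen to be `span_ℚ{w_n, h}`, where `h ∈ w_n^⊥` and `(h, h)_{S⁺} < 0`. The class `ℓ` is the projection¹² of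
  `−c₁(𝒫)/2` to `H²(X × X̂, ℚ)_P`, by Remark 6.2.4. We conclude the equality (6.2.5)
  `c₁(N_g) = ½[c₁(𝒫) − ρ_g(c₁(𝒫))]`, for all `g ∈ Spin(V)_P`, …»

## The model and what is proved (0 `def`, 0 named fact, 0 sorry)

`A` a commutative `ℚ`-algebra («`H^{ev}(X × X̂, ℚ)`»), `ρ : A →+* A` («`ρ_g`», a ring endomorphism), `exp` = Mathlib's
`IsNilpotent.exp`; graded pieces enter as separate elements `bk = β_k`, `bk1 = β_{k+1}`, `c = c₁(N_g)`, `ℓ`,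
`γ = β_{k+1} + β_kℓ`. The DEGREE-`(k+1)` READING of (6.2.4) — `ρ_g(β_{k+1}) = β_{k+1} − c₁(N_g)β_k` (`ch(N_g) = 1 + c₁(N_g)
+ ⋯`, `ρ_g` degree-preserving, `β_j = 0` for `j < k`, `ρ_g(β_k) = β_k`) — is the printed «first equality» and enters
as the hypothesis `h624`; the module `H² = H²_P ⊕ ℚΞ_P` enters through a projection `pr` onto `H²_P` with
`pr Ξ = 0`, `pr ∘ ρ = ρ ∘ pr` (both summands are subrepresentations), `ρ Ξ = Ξ`, and «`H²_P` has no non-zero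
invariants» (`hnoinv`). THEOREMS. §A LEMMA 6.2.3: `first_display`, `second_display` (the two displayed lines),
`bk_mul_eq_zero` (`β_k·[c₁(N_g) + ℓ − ρ_g(ℓ)] = 0`), `c1_eq` («We conclude that `c₁(N_g) = ρ_g(ℓ) − ℓ` … by the
injectivity of the cup product with `β_k`»), `ell_eq_zero_iff` («`ℓ = 0`, if and only if `c₁(N_g) = 0`, for all `g`»),
`ell_unique` («then `ℓ − ℓ′` is … invariant …, hence `ℓ′ = ℓ`»), `rho_beta` ((6.2.4) ⇒ `ρ_g(β) = ch(N_g⁻¹)β` with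
`ch(N_g^{±1}) = exp(±c₁(N_g))`), `alpha_invariant` (the chain `ρ_g(α) = exp(ρ_gℓ)ch(N_g⁻¹)β = exp(ρ_gℓ)exp(ℓ − ρ_gℓ)β
= exp(ℓ)β = α`); §B REMARK 6.2.4: `rem624_ell` (`k = 0`: from `α₁ = γ = β₁ + rℓ` invariant, `γ = tΞ_P` ⇒
`ℓ = (tΞ_P − β₁)/r`); §C (6.2.5): `sub_rho_mem` (`c − ρ_g c = pr(c − ρ_g c)`: the `Ξ_P`-components cancel),
`ell_surface` (`r = −2n`, `β₁ = −nc₁(𝒫)`, `ℓ ∈ H²_P` ⇒ `ℓ = pr(−c₁(𝒫)/2)`, the footnoted «projection of `−c₁(𝒫)/2`»),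
`eq625` («`c₁(N_g) = ρ_g(ℓ) − ℓ = ½[c₁(𝒫) − ρ_g(c₁(𝒫))]`»). BY VALUE ∕ NOT modelled: `Φ`, `ch`, (6.1.8), Lemma 2.2.7,
the minimality of `k` and «`β_k` is a non-zero multiple of `Ξ_P^k`», ampleness ⇒ injectivity of `β_k ∪`, the
existence half of «there exists a uniques class `ℓ`» (the coset argument), the `ch(E)` display of Lemma 6.2.5
([M2, Prop. 11.2]; cf. `HodgeTheory/ModularSheafCayleyClass.lean`) beyond `r = −2n`, `β₁ = −nc₁(𝒫)`, the cocycle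
extension to `Γ` and the density argument closing Lemma 6.2.5. Nothing here says any object is semiregular or that
HC ∕ HC_CM ∕ HC_AV is proved.
-/

namespace Literature.AlgebraicGeometry.Markman2025.Lemma623

open IsNilpotent

variable {A : Type*} [CommRing A]

/-! ### §A — LEMMA 6.2.3: the two displays, `c₁(N_g) = ρ_g(ℓ) − ℓ`, uniqueness, and the invariance of `α` -/

/-- The FIRST displayed line: «`ρ_g(β_{k+1}) = −c₁(N_g)β_k + β_{k+1} = γ − [c₁(N_g) + ℓ]β_k`» — from the
degree-`(k+1)` reading of (6.2.4) (`h624`) and `γ := β_{k+1} + β_kℓ`.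
[cite: Markman2025SecantWeil, proof of Lemma 6.2.3, p. 34 L76–77 and p. 35 L3–6] -/
theorem first_display (ρ : A →+* A) (bk bk1 c ℓ γ : A) (h624 : ρ bk1 = bk1 - c * bk) (hγ : γ = bk1 + bk * ℓ) :
    ρ bk1 = -c * bk + bk1 ∧ ρ bk1 = γ - (c + ℓ) * bk := by
  constructor
  · rw [h624]; ring
  · rw [h624, hγ]; ring

/-- The SECOND displayed line: «`ρ_g(β_{k+1}) = ρ_g(γ − β_kℓ) = γ − β_kρ_g(ℓ)`» — «The invariance of `β_k` and `γ`
yields the second equality». [cite: Markman2025SecantWeil, proof of Lemma 6.2.3, p. 35 L3–9] -/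
theorem second_display (ρ : A →+* A) (bk bk1 ℓ γ : A) (hγ : γ = bk1 + bk * ℓ) (hρbk : ρ bk = bk)
    (hργ : ρ γ = γ) : ρ bk1 = ρ (γ - bk * ℓ) ∧ ρ (γ - bk * ℓ) = γ - bk * ρ ℓ := by
  constructor
  · rw [hγ]; ring_nf
  · rw [map_sub, map_mul, hργ, hρbk]

/-- Comparing the two displays: `β_k · [c₁(N_g) + ℓ − ρ_g(ℓ)] = 0`.
[cite: Markman2025SecantWeil, proof of Lemma 6.2.3, p. 35 L3–12] -/
theorem bk_mul_eq_zero (ρ : A →+* A) (bk bk1 c ℓ γ : A) (h624 : ρ bk1 = bk1 - c * bk)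
    (hγ : γ = bk1 + bk * ℓ) (hρbk : ρ bk = bk) (hργ : ρ γ = γ) : bk * (c + ℓ - ρ ℓ) = 0 := by
  have h1 := (first_display ρ bk bk1 c ℓ γ h624 hγ).2
  have h2 := second_display ρ bk bk1 ℓ γ hγ hρbk hργ
  have h3 : γ - (c + ℓ) * bk = γ - bk * ρ ℓ := by rw [← h1, h2.1, h2.2]
  linear_combination -h3

/-- «We conclude that `c₁(N_g) = ρ_g(ℓ) − ℓ`, for all `g ∈ Spin(V)_P`, by the injectivity of the cup product with `β_k`»
(injectivity = `hinj`, BY VALUE from «`β_k` is a non-zero scalar multiple of `Ξ_P^k` … as `Ξ_P` is ample»).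
[cite: Markman2025SecantWeil, proof of Lemma 6.2.3, p. 35 L10–12] -/
theorem c1_eq (ρ : A →+* A) (bk bk1 c ℓ γ : A) (h624 : ρ bk1 = bk1 - c * bk) (hγ : γ = bk1 + bk * ℓ)
    (hρbk : ρ bk = bk) (hργ : ρ γ = γ) (hinj : ∀ x, bk * x = 0 → x = 0) : c = ρ ℓ - ℓ := by
  have h := hinj _ (bk_mul_eq_zero ρ bk bk1 c ℓ γ h624 hγ hρbk hργ)
  linear_combination h

section Uniqueness

variable [Algebra ℚ A] {G : Type*} (ρ : G → A →+* A) {L : Submodule ℚ A}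

/-- «In particular, `ℓ = 0`, if and only if `c₁(N_g) = 0`, for all `g ∈ Spin(V)_P`» — given `c₁(N_g) = ρ_g(ℓ) − ℓ` for
all `g` and that `H²_P` (the submodule `L ∋ ℓ`) has no non-zero `Spin(V)_P`-invariant class (`hnoinv`).
[cite: Markman2025SecantWeil, proof of Lemma 6.2.3, p. 35 L12–13] -/
theorem ell_eq_zero_iff (hnoinv : ∀ x ∈ L, (∀ g, ρ g x = x) → x = 0) (c : G → A) (ℓ : A) (hℓ : ℓ ∈ L)
    (hc : ∀ g, c g = ρ g ℓ - ℓ) : ℓ = 0 ↔ ∀ g, c g = 0 := by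
  constructor
  · intro h g
    rw [hc, h, map_zero, sub_zero]
  · intro h
    exact hnoinv ℓ hℓ fun g => by have := hc g; rw [h g] at this; linear_combination -this

/-- «Indeed, if `c₁(N_g) = ρ_g(ℓ′) − ℓ′`, for all `g ∈ Spin(V)_P`, for some `ℓ′ ∈ H²(X × X̂, ℚ)_P`, then `ℓ − ℓ′` is a
`Spin(V)_P`-invariant class in `H²(X × X̂, ℚ)_P`, hence `ℓ′ = ℓ`» (the UNIQUENESS of `ℓ`; also why `ℓ` «is independent
of the choices of `F_i`»). [cite: Markman2025SecantWeil, proof of Lemma 6.2.3, p. 35 L13–16] -/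
theorem ell_unique (hnoinv : ∀ x ∈ L, (∀ g, ρ g x = x) → x = 0) (c : G → A) (ℓ ℓ' : A) (hℓ : ℓ ∈ L)
    (hℓ' : ℓ' ∈ L) (hc : ∀ g, c g = ρ g ℓ - ℓ) (hc' : ∀ g, c g = ρ g ℓ' - ℓ') : ℓ' = ℓ := by
  have hinv : ∀ g, ρ g (ℓ - ℓ') = ℓ - ℓ' := fun g => by
    rw [map_sub]; linear_combination (hc g).symm.trans (hc' g)
  have h0 := hnoinv (ℓ - ℓ') (L.sub_mem hℓ hℓ') hinv
  linear_combination -h0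

end Uniqueness

/-- (6.2.4) «`β = ch(N_g)ρ_g(β)`» with `ch(N_g) = exp(c₁(N_g))` gives «`ρ_g(β) = ch(N_g⁻¹)β`», `ch(N_g⁻¹) = exp(−c₁(N_g))`
(nilpotent `c₁`). [cite: Markman2025SecantWeil, (6.2.4), p. 34 L61–65; p. 35 L18–20] -/
theorem rho_beta [Algebra ℚ A] (ρ : A →+* A) (β c : A) (hc : IsNilpotent c) (h624 : β = exp c * ρ β) :
    ρ β = exp (-c) * β := by
  conv_rhs => rw [h624]
  rw [← mul_assoc, exp_neg_mul_exp_self hc, one_mul]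

/-- «Set `α := exp(ℓ)β`. Then … `α` is `Spin(V)_P`-invariant, since `ρ_g(α) = ρ_g(exp(ℓ))ρ_g(β) =
exp(ρ_g(ℓ))ch(N_g⁻¹)β = exp(ρ_g(ℓ))exp(ℓ − ρ_g(ℓ))β = exp(ℓ)β = α`» — with `c₁(N_g) = ρ_g(ℓ) − ℓ` (`hc`) and (6.2.4)
(`h624`); `ℓ` nilpotent (a class of positive degree). [cite: Markman2025SecantWeil, proof of Lemma 6.2.3, p. 35 L17–21] -/
theorem alpha_invariant [Algebra ℚ A] (ρ : A →+* A) (β c ℓ : A) (hℓ : IsNilpotent ℓ) (hc : c = ρ ℓ - ℓ)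
    (h624 : β = exp c * ρ β) : ρ (exp ℓ * β) = exp ℓ * β := by
  have hρℓ : IsNilpotent (ρ ℓ) := hℓ.map ρ
  have hcn : IsNilpotent c := by rw [hc]; exact (Commute.all _ _).isNilpotent_sub hρℓ hℓ
  -- «ρ_g(exp ℓ)ρ_g(β) = exp(ρ_g ℓ) ch(N_g⁻¹) β»
  rw [map_mul, map_exp hℓ ρ, rho_beta ρ β c hcn h624, ← mul_assoc,
    -- «= exp(ρ_g ℓ) exp(ℓ − ρ_g ℓ) β = exp(ℓ) β»
    ← exp_add_of_commute (Commute.all _ _) hρℓ hcn.neg]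
  congr 2
  rw [hc]; ring

/-- «Then `α_{k+1} = γ`»: the degree-`(k+1)` part of `exp(ℓ)β` is `β_{k+1} + ℓβ_k` (`exp(ℓ) = 1 + ℓ + ⋯`, `β_j = 0` for
`j < k`), which is `γ`. [cite: Markman2025SecantWeil, proof of Lemma 6.2.3, p. 35 L17–18] -/
theorem alpha_k1 (bk bk1 ℓ γ : A) (hγ : γ = bk1 + bk * ℓ) : bk1 + ℓ * bk = γ := by
  rw [hγ]; ring

/-! ### §B — REMARK 6.2.4: `k = 0`, `ℓ = (tΞ_P − β₁)/r` -/

/-- REMARK 6.2.4: with `k = 0` (`β₀ = r ≠ 0` the rank) the invariant class `γ = α₁ = β₁ + rℓ` lies in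
`H²(X × X̂, ℚ)^{Spin(V)_P} = ℚΞ_P`, say `γ = tΞ_P`; hence «`ℓ = (tΞ_P − β₁)/r`».
[cite: Markman2025SecantWeil, Remark 6.2.4, p. 35 L22–30] -/
theorem rem624_ell {M : Type*} [AddCommGroup M] [Module ℚ M] (r t : ℚ) (hr : r ≠ 0) (Ξ β₁ ℓ γ : M)
    (hγ : γ = β₁ + r • ℓ) (hγt : γ = t • Ξ) : ℓ = r⁻¹ • (t • Ξ - β₁) := by
  rw [← hγt, hγ, add_sub_cancel_left, smul_smul, inv_mul_cancel₀ hr, one_smul]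

/-- … and then `exp(ℓ)β = exp(tΞ_P/r)·κ`, `κ = exp(−β₁/r)β` — the twist relating Lemma 6.2.3's `α` to the class
«`κ(Φ(F₂ ⊠ F₁^∨)) := exp(−β₁/r)ch(Φ(F₂ ⊠ F₁^∨))`» (both factors nilpotent and commuting).
[cite: Markman2025SecantWeil, Remark 6.2.4, p. 35 L22–30] -/
theorem rem624_alpha_kappa [Algebra ℚ A] (r t : ℚ) (Ξ β₁ β : A) (hΞ : IsNilpotent Ξ) (hβ₁ : IsNilpotent β₁) :
    exp (r⁻¹ • (t • Ξ - β₁)) * β = exp ((r⁻¹ * t) • Ξ) * (exp (-(r⁻¹ • β₁)) * β) := by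
  have h1 : IsNilpotent ((r⁻¹ * t) • Ξ) := hΞ.smul _
  have h2 : IsNilpotent (-(r⁻¹ • β₁)) := (hβ₁.smul _).neg
  rw [← mul_assoc, ← exp_add_of_commute (Commute.all _ _) h1 h2]
  congr 2
  rw [smul_sub, smul_smul, sub_eq_add_neg]

/-! ### §C — LEMMA 6.2.5: `ℓ = pr(−c₁(𝒫)/2)` and (6.2.5) `c₁(N_g) = ½[c₁(𝒫) − ρ_g(c₁(𝒫))]` -/

section Surface

variable {M : Type*} [AddCommGroup M] [Module ℚ M] (pr : M →ₗ[ℚ] M) (ρ : M →ₗ[ℚ] M) (Ξ : M)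

/-- In `H² = H²_P ⊕ ℚΞ_P` (projection `pr` onto `H²_P`, `pr Ξ_P = 0`, `pr` and `ρ_g` commute, `ρ_g Ξ_P = Ξ_P`): for any
class `c = pr c + λΞ_P` one has `c − ρ_g c = pr(c − ρ_g c) ∈ H²_P` (the `Ξ_P`-components cancel).
[cite: Markman2025SecantWeil, proof of Lemma 6.2.5, p. 35 L54–62; Lemma 6.2.3 setting p. 34 L45–47] -/
theorem sub_rho_mem (hρpr : ∀ x, ρ (pr x) = pr (ρ x)) (hρΞ : ρ Ξ = Ξ) (c : M) (lam : ℚ)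
    (hdec : c = pr c + lam • Ξ) : c - ρ c = pr (c - ρ c) := by
  have h1 : ρ c = pr (ρ c) + lam • Ξ := by
    conv_lhs => rw [hdec]
    rw [map_add, map_smul, hρΞ, hρpr]
  rw [map_sub]
  nth_rewrite 1 [hdec, h1]
  abel

/-- «The first Chern class … is `β₁ = −nc₁(𝒫)`», rank `r = ch₀(E) = −2n` (`n ≥ 1`), and Remark 6.2.4's
`ℓ = (tΞ_P − β₁)/r` with `ℓ ∈ H²_P` (`pr ℓ = ℓ`, `pr Ξ_P = 0`): «The class `ℓ` is the projection of `−c₁(𝒫)/2` to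
`H²(X × X̂, ℚ)_P`». [cite: Markman2025SecantWeil, proof of Lemma 6.2.5, p. 35 L50–58] -/
theorem ell_surface (hprΞ : pr Ξ = 0) (n t : ℚ) (hn : n ≠ 0) (c ℓ : M)
    (hℓ : ℓ = (-2 * n)⁻¹ • (t • Ξ - (-n) • c)) (hℓP : pr ℓ = ℓ) : ℓ = pr (-(1 / 2 : ℚ) • c) := by
  have key : pr ((-2 * n)⁻¹ • (t • Ξ - (-n) • c)) = (-(1 / 2 : ℚ)) • pr c := by
    rw [map_smul, map_sub, map_smul, map_smul, hprΞ, smul_zero, zero_sub, smul_neg, smul_smul, ← neg_smul]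
    congr 1
    field_simp
  rw [← hℓP, hℓ, key, map_smul]

/-- **(6.2.5)** «We conclude the equality `c₁(N_g) = ½[c₁(𝒫) − ρ_g(c₁(𝒫))]`»: `c₁(N_g) = ρ_g(ℓ) − ℓ` (Lemma 6.2.3) with
`ℓ = pr(−c₁(𝒫)/2)`, `pr` commuting with `ρ_g`, and `c₁(𝒫) − ρ_g c₁(𝒫) ∈ H²_P` (`sub_rho_mem`).
[cite: Markman2025SecantWeil, (6.2.5), p. 35 L58–62] -/
theorem eq625 (hρpr : ∀ x, ρ (pr x) = pr (ρ x)) (hρΞ : ρ Ξ = Ξ) (c ℓ cN : M) (lam : ℚ)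
    (hdec : c = pr c + lam • Ξ) (hℓ : ℓ = pr (-(1 / 2 : ℚ) • c)) (hcN : cN = ρ ℓ - ℓ) :
    cN = (1 / 2 : ℚ) • (c - ρ c) := by
  have hmem := sub_rho_mem pr ρ Ξ hρpr hρΞ c lam hdec
  have key : ρ (-(1 / 2 : ℚ) • c) - (-(1 / 2 : ℚ)) • c = (1 / 2 : ℚ) • (c - ρ c) := by
    rw [map_smul]; module
  rw [hcN, hℓ, hρpr, ← map_sub, key, map_smul, ← hmem]

end Surface

end Literature.AlgebraicGeometry.Markman2025.Lemma623
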